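import Mathlib
import Literature.Geometry.DiscreteGeometry.LayerShells

/-!
# Crux `GappedShellCensus.FiveFoldRationingR` (stmt-AtomisticToContinuum-18071), line `Sketch` —
# helper for stub `stub_ffrC5Cert` (registered sub-goal `stub_ffrC5CertFacetSign`): the
# determinant form of the facet condition (soundness core of the facet leaf of a (C2) certificate)

The dictionary half of conjunct (C2) of `stub_ffrC5Cert` (`stub_ffrC5CertFacesOf`) reduces (C2) to
refuting, for a gapped twelve-tuple `t`, a SUPPORTING FUNCTIONAL of the normalised shell
`u k = t k / ‖t k‖` through three labels `p, q, r`: a vector `c` with `⟪c, u p⟫ = ⟪c, u q⟫ = ⟪c, u r⟫ = 1`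
and `⟪c, u l⟫ ≤ 1` for every `l`.  A box-search certificate cannot quantify over `c`; it tests SIGNS OF
POLYNOMIALS in the coordinates.  This file supplies the test: for every label `l`,

  `det[t p, t q, t r] · ( ‖t p‖·det[t q, t r, t l] − ‖t q‖·det[t p, t r, t l] + ‖t r‖·det[t p, t q, t l]
      − ‖t l‖·det[t p, t q, t r] ) ≤ 0`,

so a box on which interval arithmetic shows this product POSITIVE for some `l` carries no supporting
functional through `p, q, r` (the `aboveFacet` leaf of the certificate spec, memo C5Cert-recon.md §4.3).

## Proof

Pure linear algebra.  With unit rows `v = u p`, `w = u q`, `z = u r` and `D = det[v, w, z]`, Cramer's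
rule in adjugate form — obtained by `linear_combination` of the three equations `⟪c, ·⟫ = 1` with
cofactor coefficients — gives `D · c = adj[v,w,z] · (1,1,1)ᵀ`, hence
`D² ⟪c, s⟫ = D · P(s)` with `P(s) = Σⱼ (Σᵢ cofᵢⱼ) sⱼ`, and the polynomial identity
`det[w − v, z − v, s − v] = P(s) − D = det[w,z,s] − det[v,z,s] + det[v,w,s] − det[v,w,z]`.  So
`D · det[w − v, z − v, s − v] = D² (⟪c, s⟫ − 1) ≤ 0` for `s = u l`.  Clearing the positive norms
(`u k = ‖t k‖⁻¹ t k`) multiplies this by `‖t p‖² ‖t q‖² ‖t r‖² ‖t l‖ > 0` and yields the displayed raw form.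
Coordinates of the inner product: `inner_fin3` (`LayerShells.lean`).
-/

noncomputable section

namespace Summit.AtomisticToContinuum.Crystallization.Theorems

/-- **Cramer/adjugate core.**  If `c` has inner product `1` with the rows `v, w, z` and `≤ 1` with `s`,
then `det[v,w,z] · (det[w,z,s] − det[v,z,s] + det[v,w,s] − det[v,w,z]) ≤ 0` (the second factor is
`det[w − v, z − v, s − v]`). [folklore] -/
theorem ffrC5FS_core (v0 v1 v2 w0 w1 w2 z0 z1 z2 s0 s1 s2 c0 c1 c2 : ℝ)
    (hv : c0 * v0 + c1 * v1 + c2 * v2 = 1) (hw : c0 * w0 + c1 * w1 + c2 * w2 = 1)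
    (hz : c0 * z0 + c1 * z1 + c2 * z2 = 1) (hs : c0 * s0 + c1 * s1 + c2 * s2 ≤ 1) :
    (v0 * (w1 * z2 - w2 * z1) - v1 * (w0 * z2 - w2 * z0) + v2 * (w0 * z1 - w1 * z0)) *
      ((w0 * (z1 * s2 - z2 * s1) - w1 * (z0 * s2 - z2 * s0) + w2 * (z0 * s1 - z1 * s0))
        - (v0 * (z1 * s2 - z2 * s1) - v1 * (z0 * s2 - z2 * s0) + v2 * (z0 * s1 - z1 * s0))
        + (v0 * (w1 * s2 - w2 * s1) - v1 * (w0 * s2 - w2 * s0) + v2 * (w0 * s1 - w1 * s0))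
        - (v0 * (w1 * z2 - w2 * z1) - v1 * (w0 * z2 - w2 * z0) + v2 * (w0 * z1 - w1 * z0))) ≤ 0 := by
  set D : ℝ := v0 * (w1 * z2 - w2 * z1) - v1 * (w0 * z2 - w2 * z0) + v2 * (w0 * z1 - w1 * z0) with hD
  -- cofactors of the matrix with rows `v, w, z`
  -- adjugate identities `D · cⱼ = Σᵢ cofᵢⱼ`
  have h0 : D * c0 = (w1 * z2 - w2 * z1) - (v1 * z2 - v2 * z1) + (v1 * w2 - v2 * w1) := by
    rw [hD]
    linear_combination (w1 * z2 - w2 * z1) * hv - (v1 * z2 - v2 * z1) * hw + (v1 * w2 - v2 * w1) * hz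
  have h1 : D * c1 = -(w0 * z2 - w2 * z0) + (v0 * z2 - v2 * z0) - (v0 * w2 - v2 * w0) := by
    rw [hD]
    linear_combination (-(w0 * z2 - w2 * z0)) * hv + (v0 * z2 - v2 * z0) * hw - (v0 * w2 - v2 * w0) * hz
  have h2 : D * c2 = (w0 * z1 - w1 * z0) - (v0 * z1 - v1 * z0) + (v0 * w1 - v1 * w0) := by
    rw [hD]
    linear_combination (w0 * z1 - w1 * z0) * hv - (v0 * z1 - v1 * z0) * hw + (v0 * w1 - v1 * w0) * hz
  -- `D² ⟪c, s⟫ = D · P(s)` and `det[w − v, z − v, s − v] = P(s) − D`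
  have hP : D * (D * (c0 * s0 + c1 * s1 + c2 * s2)) =
      D * (((w1 * z2 - w2 * z1) - (v1 * z2 - v2 * z1) + (v1 * w2 - v2 * w1)) * s0
        + (-(w0 * z2 - w2 * z0) + (v0 * z2 - v2 * z0) - (v0 * w2 - v2 * w0)) * s1
        + ((w0 * z1 - w1 * z0) - (v0 * z1 - v1 * z0) + (v0 * w1 - v1 * w0)) * s2) := by
    linear_combination (D * s0) * h0 + (D * s1) * h1 + (D * s2) * h2
  have hE : (w0 * (z1 * s2 - z2 * s1) - w1 * (z0 * s2 - z2 * s0) + w2 * (z0 * s1 - z1 * s0))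
        - (v0 * (z1 * s2 - z2 * s1) - v1 * (z0 * s2 - z2 * s0) + v2 * (z0 * s1 - z1 * s0))
        + (v0 * (w1 * s2 - w2 * s1) - v1 * (w0 * s2 - w2 * s0) + v2 * (w0 * s1 - w1 * s0))
        - (v0 * (w1 * z2 - w2 * z1) - v1 * (w0 * z2 - w2 * z0) + v2 * (w0 * z1 - w1 * z0)) =
      (((w1 * z2 - w2 * z1) - (v1 * z2 - v2 * z1) + (v1 * w2 - v2 * w1)) * s0
        + (-(w0 * z2 - w2 * z0) + (v0 * z2 - v2 * z0) - (v0 * w2 - v2 * w0)) * s1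
        + ((w0 * z1 - w1 * z0) - (v0 * z1 - v1 * z0) + (v0 * w1 - v1 * w0)) * s2) - D := by
    rw [hD]; ring
  rw [hE]
  have key : D * ((((w1 * z2 - w2 * z1) - (v1 * z2 - v2 * z1) + (v1 * w2 - v2 * w1)) * s0
        + (-(w0 * z2 - w2 * z0) + (v0 * z2 - v2 * z0) - (v0 * w2 - v2 * w0)) * s1
        + ((w0 * z1 - w1 * z0) - (v0 * z1 - v1 * z0) + (v0 * w1 - v1 * w0)) * s2) - D) =
      D ^ 2 * ((c0 * s0 + c1 * s1 + c2 * s2) - 1) := by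
    linear_combination (-1 : ℝ) * hP
  rw [key]
  exact mul_nonpos_of_nonneg_of_nonpos (sq_nonneg D) (by linarith)

/-- **Sub-stub `stub_ffrC5CertFacetSign` (determinant form of the facet condition).**  For a twelve-tuple
with norms in `[0.98, 1.02]`: if `c` is a supporting functional of the normalised shell through the labels
`p, q, r` (`⟪c, u p⟫ = ⟪c, u q⟫ = ⟪c, u r⟫ = 1`) and `⟪c, u l⟫ ≤ 1`, then
`det[t p,t q,t r] · (‖t p‖ det[t q,t r,t l] − ‖t q‖ det[t p,t r,t l] + ‖t r‖ det[t p,t q,t l] − ‖t l‖ det[t p,t q,t r]) ≤ 0`.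
[folklore] -/
theorem stub_ffrC5CertFacetSign (t : Fin 12 → EuclideanSpace ℝ (Fin 3))
    (hn : ∀ k, 1 - 1 / 50 ≤ ‖t k‖ ∧ ‖t k‖ ≤ 1 + 1 / 50) (p q r l : Fin 12) (c : EuclideanSpace ℝ (Fin 3))
    (hcp : inner ℝ c (‖t p‖⁻¹ • t p) = 1) (hcq : inner ℝ c (‖t q‖⁻¹ • t q) = 1)
    (hcr : inner ℝ c (‖t r‖⁻¹ • t r) = 1) (hcl : inner ℝ c (‖t l‖⁻¹ • t l) ≤ 1) :
    Matrix.det !![t p 0, t p 1, t p 2; t q 0, t q 1, t q 2; t r 0, t r 1, t r 2] *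
      (‖t p‖ * Matrix.det !![t q 0, t q 1, t q 2; t r 0, t r 1, t r 2; t l 0, t l 1, t l 2]
        - ‖t q‖ * Matrix.det !![t p 0, t p 1, t p 2; t r 0, t r 1, t r 2; t l 0, t l 1, t l 2]
        + ‖t r‖ * Matrix.det !![t p 0, t p 1, t p 2; t q 0, t q 1, t q 2; t l 0, t l 1, t l 2]
        - ‖t l‖ * Matrix.det !![t p 0, t p 1, t p 2; t q 0, t q 1, t q 2; t r 0, t r 1, t r 2]) ≤ 0 := by
  have hpos : ∀ k, 0 < ‖t k‖ := fun k => by linarith [(hn k).1]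
  set np : ℝ := ‖t p‖ with hnp
  set nq : ℝ := ‖t q‖ with hnq
  set nr : ℝ := ‖t r‖ with hnr
  set nl : ℝ := ‖t l‖ with hnl
  have hp0 : np ≠ 0 := (hpos p).ne'
  have hq0 : nq ≠ 0 := (hpos q).ne'
  have hr0 : nr ≠ 0 := (hpos r).ne'
  have hl0 : nl ≠ 0 := (hpos l).ne'
  have hsm : ∀ (a : ℝ) (x : EuclideanSpace ℝ (Fin 3)) (j : Fin 3), (a • x) j = a * x j :=
    fun a x j => by simp
  rw [Literature.Geometry.DiscreteGeometry.inner_fin3] at hcp hcq hcr hcl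
  simp only [hsm] at hcp hcq hcr hcl
  have key := ffrC5FS_core (np⁻¹ * t p 0) (np⁻¹ * t p 1) (np⁻¹ * t p 2) (nq⁻¹ * t q 0) (nq⁻¹ * t q 1)
    (nq⁻¹ * t q 2) (nr⁻¹ * t r 0) (nr⁻¹ * t r 1) (nr⁻¹ * t r 2) (nl⁻¹ * t l 0) (nl⁻¹ * t l 1)
    (nl⁻¹ * t l 2) (c 0) (c 1) (c 2) (by linarith [hcp]) (by linarith [hcq]) (by linarith [hcr])
    (by linarith [hcl])
  simp only [Matrix.det_fin_three, Matrix.of_apply, Matrix.cons_val', Matrix.cons_val_zero,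
    Matrix.cons_val_one, Matrix.cons_val_two, Matrix.cons_val_fin_one, Matrix.empty_val',
    Matrix.head_cons, Matrix.tail_cons, Matrix.head_fin_const]
  have hscale : ∀ X Y : ℝ, X * Y ≤ 0 → 0 ≤ np ^ 2 * nq ^ 2 * nr ^ 2 * nl →
      X * Y * (np ^ 2 * nq ^ 2 * nr ^ 2 * nl) ≤ 0 := fun X Y h h' =>
    mul_nonpos_of_nonpos_of_nonneg h h'
  have hnn : 0 ≤ np ^ 2 * nq ^ 2 * nr ^ 2 * nl := by
    have := hpos l
    positivity
  have fin := hscale _ _ key hnn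
  convert fin using 1
  field_simp
  ring

end Summit.AtomisticToContinuum.Crystallization.Theorems

end
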